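import Literature.MathematicalPhysics.QuantumFieldTheory.Balaban1983to89.B9SupplySockB9P3ZdAtJoint
import Literature.MathematicalPhysics.QuantumFieldTheory.Balaban1983to89.B8SockB9P3ShellModeVacuityUniv

/-!
# `Balaban1983to89.B8SockB9P3UnivBinderVacuity` — KERNEL COROLLARY (consequence of dag-n05-c's located INTERIOR-SHELL gauge mode, [Balaban1985RegularSpaces]
# (1.59) p. 86 ∕ (1.31) p. 82): ON THE `Ω₀ = ℤᵈ` ROAD OF N05, N06's `B9.Thm33Printed` AND dag-n06-b's member-local operator dictionary at ALL law members and ALL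
# truncations `m` are JOINTLY UNSATISFIABLE — the hypothesis sets of the `Ω₀ = ℤᵈ`-keyed N05 knits that take both (`Summits/…/BalabanUVNodesN05SubBHKnitUnivOfThm33(Lin,
# P6Beta)`, their ₁₃ images) are unsatisfiable AS TYPED at exactly the binder level they declare A6-UNCHECKED (`m ≥ 1`)

statement-level skeleton of published theorems with citation tags; proofs where landed; nothing here is a claim about the
Yang–Mills mass gap

`[Balaban1985RegularSpaces]` ("B8", CMP **99** (1985) 75–102) (1.58)–(1.59) p. 86, (1.31) p. 82 («All sites of the contours Γ_{b₋,x} belong to Λ_{j−1}»), Thm 4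
p. 88, p. 77 («we admit Ω_j = T_η»); [4] = `[Balaban1985BackgroundPropagators]` Thm 3.3 p. 399.  PDF held: `paper:balaban1985-cmp99-regular-spaces-gauge-fixing`.

CITATION HEADER (lean-in-tree rule).  Cell `pub-ymgap` (YM Track A, HUMAN RULING D-0062), DAG node N05 = [B8], seat `pub-ymgap-dag-n05-d` (g9; the author of the
knits concerned).  WHY.  dag-n05-c g11 located and certified (`B8Ineq159FlatShellModeVacuity`, p572834; `B8SockB9P3ShellModeVacuityUniv`, p576185, the `Ω₀ = ℤᵈ` twin typed on this seat's REQUEST) an interior-shell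
gauge zero mode `φ = ∂λ` (`λ` supported inside `Ω₁`) that is a datum of every (1.59)-type socket whose averaging datum `|B₁|` ranges over the tree's bond classes
`cubeLamB` ∕ `towerBonds` — whose CROSSING disjuncts are EMPTY under `ZdIdx.hbox` («box ⊂ Ω_j») for every print-like tower, so print's (1.31) crossing contours are
missing — with ALL right-hand data zero: the law-member socket `SockB9P3 … m …` (law №12: `Λb = towerBonds`) is FALSE at `m = 1` at a LAWFUL member of the
sub-index of record `IdxB8SubB θ` with a cube shell `Ω₁` (`not_sB9all_idxB8SubB`).  THIS FILE draws the consequence for this seat's lineage BY NAME: dag-n06-b's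
explicit family `B9SupplySockB9P3ZdAtJoint.sockB9P3_allLevels_univ_explicit_on` DERIVES that socket at every `IdxB8SubB` member and every `m ≤ k` from
`B9.Thm33Printed` + the seven member-local binders `DictAt ∕ Prop6At ∕ InvAt ∕ CurvAt ∕ LandauAt ∕ AvgAt ∕ HolderAt` (positivity of `K₆`, `c69 ≥ 0`, `q ≥ 0`), hence
★★ `thm33_lawDict_idxB8SubB_false`: those hypotheses — VERBATIM the `h33 … hhol` binder block of `exists_b8LeafOfRecordSubBH_cutSubB_zdLan_of_thm33_lettersRDU_univ(_lin,
_lin_p6β)` — yield `False`.  CONSEQUENCE (count-neutral; verdicts of record PASS-AS-DECLARED unchanged): p551339 · p558407 · p555933 · p566904 · p568513 (and the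
g5–g7 univ knits p514768 … p521275 through their `SB9all` display, `sB9all_idxB8SubB_false`) are VACUOUS AS TYPED; dag-n06-b's truncation-0 witnesses
(`binders_inhabited_univ_zero(_lin)`) remain the only inhabited slice.  REPAIR (dag-n05-c; dag-lead REBALANCE WORD I.23531): the INDEX LAWS — `ZdIdx.hbox` admitting
crossing bonds with box ⊂ Ω_{j−1}, `hclass`'s crossing disjuncts inhabited, `towerBonds` ∕ `cubeLamB` re-typed to print's class ([B6] (2.3), lit-balaban p21 `LamBond`),
the Theorem-4 driver's `|B₁|` supply extended — then dag-n06-b's dictionary and the knits are re-run (this seat's generators `HOME/pub-ymgap-dag-n05-d/lean/g9/tools/`).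

HONEST SCOPE.  By-name composition into a negative typing certificate; nothing of [4] ∕ [Balaban1985RegularSpaces] proved or refuted (print is consistent: its `|B₁|`
ranges over (1.31)'s contours); N05 NOT discharged; SECOND-GAP: none; one finite `T⁴` programme at fixed `ε`, Bałaban as printed; nothing continuum ∕ ℝ⁴ ∕ OS ∕
mass-gap ∕ Clay.  No `sorry`, no `def`, no `instance`, no `notation`.  Unit `pub-ymgap-dag-n05-d` (g9), 2026-08-27.
-/

noncomputable section

namespace Literature.MathematicalPhysics.QuantumFieldTheory.Balaban1983to89.B8SockB9P3UnivBinderVacuity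

open NormedSpace
open B7Prop1Explicit B7Prop2Explicit
open B8LeafModelZd (ZdIdx)
open B8LeafModelZd3 (SockB9P3)
open B8IdxB8LawsB (IdxB8LawsB IdxB8SubB)
open B9SupplySockB9P3ZdLetters (OpsZd)
open B9SupplySockB9P3ZdAt (DictAt Prop6At InvAt CurvAt LandauAt AvgAt HolderAt)
open B9SupplySockB9P3ZdAtJoint (sockB9P3_allLevels_univ_explicit_on)
open B8SockB9P3ShellModeVacuityUniv (not_sB9all_idxB8SubB)
open Node00 (Stage3Params)

export B7Prop1Explicit (Site)

variable {d : ℕ}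

/-- ★ **THE KNITS' OWN `SB9all`-OVER-THE-LAW-MEMBERS DISPLAY YIELDS `False`** — the EXACT binder text of p521275
`b8LeafOfRecordSubBH_cutSubB_zdLan_of_knit_lettersRDUB_univ_t8srv` (`∀ i : ZdIdx θ.D θ.L, i.Ω 0 = univ → IdxB8LawsB θ.L i → ∀ m ≤ i.k, SockB9P3 …`) with `0 < B₀`, `0 < cB9`
is contradictory for EVERY `B₀, B₀β, β, len` and `cB9 > 0` (dag-n05-c's `not_sB9all_idxB8SubB`, p576185, at the sub-index `IdxB8SubB θ`).
[cite: Balaban1985RegularSpaces, (1.58)–(1.59) p.86, (1.31) p.82, Thm 4 p.88, p.77; Balaban1985BackgroundPropagators, Thm 3.3 p.399] -/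
theorem sB9all_idxB8SubB_false {θ : Stage3Params} (hD : 2 ≤ θ.D) {B₀ B₀β cB9 β : ℝ} {len : Site θ.D → ℝ} (hcB9 : 0 < cB9)
    (SB9all : ∀ i : ZdIdx θ.D θ.L, i.Ω 0 = Set.univ → IdxB8LawsB θ.L i → ∀ m, m ≤ i.k →
      SockB9P3 (𝔸 := θ.𝔸) θ.L B₀ B₀β cB9 β len i.η m i.Ω i.Λs i.Λb) : False :=
  not_sB9all_idxB8SubB (θ := θ) hD B₀ B₀β cB9 β len hcB9 fun i m hm => SB9all i.1.1 i.1.2 i.2 m hm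

/-- ★★ **N06's THEOREM 3.3 AND dag-n06-b's LAW-MEMBER DICTIONARY ARE JOINTLY UNSATISFIABLE ON THE `Ω₀ = ℤᵈ` ROAD** — for a Stage-3 parameter `θ` (`D ≥ 2`), ANY
abstract indexed geometry ∕ background ∕ kernel family `(I, geo, bg, GA, Gp)`, dictionary maps `mem ιCfg ιLoc ops`, constants `c35 c₆ K₆ M₃ a₃ c69 q CH` and Hölder data
`β, len`: the hypotheses `h33 : B9.Thm33Printed c35 geo bg Gp GA` and the member-local binders `DictAt ∕ Prop6At ∕ InvAt ∕ CurvAt ∕ LandauAt ∕ AvgAt ∕ HolderAt` at EVERY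
`Ω₀ = ℤᵈ` law member and EVERY `(M, m)` (with `0 < c₆, K₆, a₃`, `0 ≤ c69, q`) — VERBATIM the binder block of this seat's junction-applied knits — imply `False`.  Proof:
Theorem 3.3 opened once; dag-n06-b's `sockB9P3_allLevels_univ_explicit_on` at the sub-index of record `j : IdxB8SubB θ ↦ j.1.1` gives the all-levels socket at
`B₀′ = max{1, 2B₀max{1,q}} > 0`, `cP > 0`; `sB9all_idxB8SubB_false`.  (The guarded edition's `LinBddAt` and the source letters are not even needed.)
[cite: Balaban1985RegularSpaces, (1.58)–(1.59) p.86, (1.31) p.82, Thm 4 p.88, p.77; Balaban1985BackgroundPropagators, Thm 3.3 p.399, (3.16) p.393, (3.20)–(3.27) pp.394–395, (3.35) p.396, (3.41)–(3.47) pp.397–398, (3.69) p.404] -/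
theorem thm33_lawDict_idxB8SubB_false {θ : Stage3Params} (hD : 2 ≤ θ.D) {β : ℝ} {len : Site θ.D → ℝ}
    {I : Type} (geo : I → B9.Geometry) (bg : I → B9.Backgrounds) (GA : ∀ i, B9.KernelFamily (geo i) (bg i)) {Gp : ∀ i, B9.KernelFamily (geo i) (bg i)}
    (mem : ℝ → ZdIdx θ.D θ.L → ℕ → I)
    (ιCfg : ∀ (M : ℝ) (i : ZdIdx θ.D θ.L) (m : ℕ) (U₀ : Site θ.D → Fin θ.D → θ.𝔸ˣ), (∀ x κ, U₀ x κ ∈ unitaryUnits θ.𝔸) → (bg (mem M i m)).Cfg)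
    (ιLoc : ∀ (M : ℝ) (i : ZdIdx θ.D θ.L) (m : ℕ), (Site θ.D → Fin θ.D → θ.𝔸) → (geo (mem M i m)).Loc)
    (ops : ℝ → ZdIdx θ.D θ.L → ℕ → OpsZd θ.D θ.𝔸)
    {c35 c₆ K₆ M₃ a₃ c69 q CH : ℝ} (h33 : B9.Thm33Printed c35 geo bg Gp GA)
    (hdict : ∀ (M : ℝ) (i : ZdIdx θ.D θ.L), i.Ω 0 = Set.univ → IdxB8LawsB θ.L i → ∀ m : ℕ, DictAt geo bg GA θ.L mem ιCfg ιLoc ops M i m)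
    (hP6at : ∀ (M : ℝ) (i : ZdIdx θ.D θ.L), i.Ω 0 = Set.univ → IdxB8LawsB θ.L i → ∀ m : ℕ, M₃ ≤ M → Prop6At bg θ.L mem ιCfg c35 c₆ K₆ M i m)
    (hinv : ∀ (M : ℝ) (i : ZdIdx θ.D θ.L), i.Ω 0 = Set.univ → IdxB8LawsB θ.L i → ∀ m : ℕ, M₃ ≤ M → InvAt bg θ.L mem ιCfg ops c35 a₃ M i m)
    (hcurv : ∀ (M : ℝ) (i : ZdIdx θ.D θ.L), i.Ω 0 = Set.univ → IdxB8LawsB θ.L i → ∀ m : ℕ, M₃ ≤ M → CurvAt bg θ.L mem ιCfg ops c35 a₃ c69 M i m)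
    (hlan : ∀ (M : ℝ) (i : ZdIdx θ.D θ.L), i.Ω 0 = Set.univ → IdxB8LawsB θ.L i → ∀ m : ℕ, M₃ ≤ M → LandauAt bg θ.L mem ιCfg ops c35 a₃ M i m)
    (havg : ∀ (M : ℝ) (i : ZdIdx θ.D θ.L), i.Ω 0 = Set.univ → IdxB8LawsB θ.L i → ∀ m : ℕ, AvgAt θ.L ops q M i m)
    (hhol : ∀ (M : ℝ) (i : ZdIdx θ.D θ.L), i.Ω 0 = Set.univ → IdxB8LawsB θ.L i → ∀ m : ℕ, HolderAt geo bg GA θ.L mem ιCfg ops β len CH M i m)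
    (hc₆ : 0 < c₆) (hK₆ : 0 < K₆) (ha₃ : 0 < a₃) (hc69 : 0 ≤ c69) (hq : 0 ≤ q) : False := by
  have hL1 : 1 ≤ θ.L := le_trans (by norm_num) θ.two_le_L
  -- ONE opening of N06's Theorem 3.3
  obtain ⟨M₁, δ₀, a₀, B₀, Bβ, Bε, Bεβ, -, -, ha₀, hB₀, H⟩ := h33
  have H' : ∀ i : I, M₁ ≤ (geo i).M → ∀ α₀ : ℝ, 0 < α₀ → (geo i).M * α₀ ≤ a₀ →
      ∀ U : (bg i).Cfg, (bg i).Reg335 c35 α₀ U →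
        B9.Ineq342_346_347 (GA i) B₀ δ₀ U ∧ B9.Ineq343_345 (GA i) Bβ Bε Bεβ δ₀ U :=
    fun i hMi α₀ hα₀ hMa U hreg => (H i hMi α₀ hα₀ hMa U hreg).2
  obtain ⟨M, hM_def⟩ : ∃ M : ℝ, M = max 1 (max M₁ M₃) := ⟨_, rfl⟩
  have hM1 : 1 ≤ M := by rw [hM_def]; exact le_max_left _ _
  have hMM₁ : M₁ ≤ M := by rw [hM_def]; exact (le_max_left _ _).trans (le_max_right _ _)
  have hMM₃ : M₃ ≤ M := by rw [hM_def]; exact (le_max_right _ _).trans (le_max_right _ _)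
  have hM0 : 0 < M := lt_of_lt_of_le one_pos hM1
  have hKM : 0 < K₆ * M := mul_pos hK₆ hM0
  -- dag-n06-b's explicit all-levels family at the SUB-INDEX OF RECORD `j : IdxB8SubB θ ↦ j.1.1`
  have hSB9 := sockB9P3_allLevels_univ_explicit_on geo bg GA θ.L mem ιCfg ιLoc ops hD hL1 hB₀ H' hM1 hMM₁ hMM₃
    (fun j : IdxB8SubB θ => j.1.1) (fun j => j.1.2) (fun M j m => hdict M j.1.1 j.1.2 j.2 m) (fun M j m hM => hP6at M j.1.1 j.1.2 j.2 m hM)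
    (fun M j m hM => hinv M j.1.1 j.1.2 j.2 m hM) (fun M j m hM => hcurv M j.1.1 j.1.2 j.2 m hM) (fun M j m hM => hlan M j.1.1 j.1.2 j.2 m hM)
    (fun M j m => havg M j.1.1 j.1.2 j.2 m) (fun M j m => hhol M j.1.1 j.1.2 j.2 m) hK₆ hc69 hq
  -- its threshold is admissible for the certificate: `cP > 0`
  have hcP : 0 < min (1 / 16) (min (c₆ / M) (min (a₀ / (K₆ * M)) (min (a₃ / (K₆ * M)) (1 / (2 * B₀ * c69 * K₆ * M + 1))))) := by
    refine lt_min (by norm_num) (lt_min (div_pos hc₆ hM0) (lt_min (div_pos ha₀ hKM) (lt_min (div_pos ha₃ hKM) ?_)))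
    have : 0 < 2 * B₀ * c69 * K₆ * M + 1 := by positivity
    positivity
  exact not_sB9all_idxB8SubB (θ := θ) hD _ _ _ _ _ hcP hSB9

#print axioms sB9all_idxB8SubB_false
#print axioms thm33_lawDict_idxB8SubB_false

end Literature.MathematicalPhysics.QuantumFieldTheory.Balaban1983to89.B8SockB9P3UnivBinderVacuity

end
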